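import Literature.Analysis.FluidPDE.WeakSolutionWeakContinuity
import Literature.Analysis.FluidPDE.LerayHopfTranslate
import Literature.Analysis.FunctionSpaces.SobolevDomainProofs
import HarnessLib

/-!
# Leray–Hopf solutions on every `[0, T')`, `T' < T`: what survives on `[0, T)`

Analysis/FluidPDE proofs file (theorems only: no definition, no named fact). Let `u` be a
Leray–Hopf weak solution of the unforced Navier–Stokes system on **every** slab `[0, T')`,
`0 < T' < T` (`IsLerayHopfOn T' ν 0 u₀ u`), with `ν > 0` — the situation of a classical solution
which is Leray–Hopf on the closed sub-slabs of its maximal interval `[0, T)`. This file collects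
what holds on `[0, T)` without touching the slice `u T` (Leray 1934, §§31–33; Galdi 2000,
Def. 2.1, Lemma 2.2):

* `kineticEnergy_le_of_forall_lt`, `eEnergy_le_of_forall_lt`, `memLqLp_of_forall_lt` — the
  energy inequality from `s = 0` gives `E(u(t)) ≤ E(u₀)` for every `t ∈ [0, T)`, so
  `u ∈ L^∞(0, T; L²)` (guarded mixed class);
* `isWeakNSSolutionOn_of_forall_lt` — `u` is a weak solution on `[0, T)` (exhaustion,
  `IsWeakNSSolutionOn.of_forall_lt`; local square integrability up to `t = T` from the energy
  bound, measurability and the divergence constraint along `T_n ↑ T`);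
* `continuousOn_integral_inner_of_forall_lt` — the `L²` pairings are continuous on `(0, T)`;
* `exists_hasWeakGradient_of_forall_lt` — **patching the weak gradients**: the gradients given
  on the slabs `[0, T_n]`, `T_n ↑ T`, are a.e. unique (`HasWeakFDerivOn.unique_holds`), so they
  patch to one `G` on `(0, T)` with `ν ∫₀ᵀ ∫ |G|² ≤ E(u₀)` (continuity from below,
  `setLIntegral_iUnion_of_directed`), satisfying the energy inequalities from `0` and from
  a.e. `s` for every final time `t < T`;
* `kineticEnergy_add_dissipation_le_of_tendsto` — the passage to `t = T` in an energy
  inequality along a weak `L²` limit `Y` of `u(t)`, `t → T⁻`: weak lower semicontinuity of the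
  energy in the elementary form `∫⟪u(t), Y⟫ - E(Y) ≤ E(u(t))`, and continuity from below of the
  dissipation `∫_{(s,t)} D ↑ ∫_{(s,T)} D`.

The sequel `LerayHopfFinalWeakSlice.lean` builds the weak `L²` limit of `u(t)` as `t → T⁻` and
assembles `IsLerayHopfOn T`. Nothing here is specific to dimension three.

## References

* J. Leray, *Sur le mouvement d'un liquide visqueux emplissant l'espace*, Acta Math. 63 (1934),
  §III, §§31–33. [Leray1934]
* G. P. Galdi, *An introduction to the Navier–Stokes initial-boundary value problem* (2000),
  Def. 2.1, Lemma 2.2. [Galdi2000]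
-/

noncomputable section

open MeasureTheory TopologicalSpace Set Function Filter
open _root_.Topology
open scoped InnerProductSpace RealInnerProductSpace ENNReal NNReal

namespace Literature.Analysis.FluidPDE

/-! ### Glue: exhaustion of an interval, `L²` norms, the limit step in an energy inequality -/

section Glue

variable {E : Type*} [NormedAddCommGroup E] [InnerProductSpace ℝ E] [FiniteDimensional ℝ E]
  [MeasurableSpace E] [BorelSpace E]

/-- Exhaustion of an open interval by the intervals cut at a sequence tending to its right end:
`⋃ₙ (a, vₙ) = (a, T)` if `vₙ → T` and `vₙ ≤ T`. [folklore] -/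
theorem iUnion_Ioo_eq_of_tendsto {a T : ℝ} {v : ℕ → ℝ} (hv : Tendsto v atTop (𝓝 T))
    (hvT : ∀ n, v n ≤ T) : ⋃ n, Ioo a (v n) = Ioo a T := by
  refine Subset.antisymm (iUnion_subset fun n => Ioo_subset_Ioo_right (hvT n)) fun t ht => ?_
  obtain ⟨n, hn⟩ := (hv.eventually (lt_mem_nhds ht.2)).exists
  exact mem_iUnion.2 ⟨n, ht.1, hn⟩

/-- The `L²` norm of the class of an `L²` field in energy form: `‖[v]‖² = 2 E(v)`. [folklore] -/
theorem norm_toLp_sq_eq_two_mul_kineticEnergy {v : E → E} (hv : MemLp v 2 (volume : Measure E)) :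
    ‖hv.toLp v‖ ^ 2 = 2 * VectorCalculus.kineticEnergy v := by
  rw [Lp.norm_toLp, ← ENNReal.toReal_pow, ← eEnergy_eq_eLpNorm_sq, eEnergy_eq_ofReal _ hv,
    ENNReal.toReal_ofReal (mul_nonneg zero_le_two (kineticEnergy_nonneg v))]

/-- **The limit step `t → T⁻` in an energy inequality along a weak `L²` limit.** Let
`E(u(t)) + ν ∫_{(s,t)} D ≤ R` for `t ∈ (s, T)`, with `∫_{(s,T)} D < ∞`, and let the slices
`u(t) ∈ L²` converge weakly to `Y ∈ L²` as `t → T⁻` in the one direction that matters,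
`∫⟪u(t), Y⟫ → ∫⟪Y, Y⟫ = 2E(Y)`. Then `E(Y) + ν ∫_{(s,T)} D ≤ R`: along `t_n ↑ T`,
`∫⟪u(t_n), Y⟫ - E(Y) + ν ∫_{(s,t_n)} D ≤ E(u(t_n)) + ν ∫_{(s,t_n)} D ≤ R` (`|⟪a,b⟫| ≤ ½|a|² + ½|b|²`)
and the left side tends to `E(Y) + ν ∫_{(s,T)} D` (continuity from below of the set integral,
`setLIntegral_iUnion_of_directed`). This is the weak lower semicontinuity of the energy used to
pass to the limit in Leray's energy inequality (Leray 1934, §33; Galdi 2000, Lemma 2.2 and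
proof of Thm. 3.1). [cite: Galdi2000, Lemma 2.2] -/
theorem kineticEnergy_add_dissipation_le_of_tendsto {s T ν R : ℝ} (hsT : s < T)
    {u : ℝ → E → E} {Y : E → E} (hY : MemLp Y 2 volume)
    (hu : ∀ t ∈ Ioo s T, MemLp (u t) 2 volume)
    (hweak : Tendsto (fun t => ∫ x, ⟪u t x, Y x⟫) (𝓝[<] T) (𝓝 (∫ x, ⟪Y x, Y x⟫)))
    {D : ℝ → ℝ≥0∞} (hfin : ∫⁻ τ in Ioo s T, D τ ≠ ∞)
    (hineq : ∀ t ∈ Ioo s T,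
      VectorCalculus.kineticEnergy (u t) + ν * (∫⁻ τ in Ioo s t, D τ).toReal ≤ R) :
    VectorCalculus.kineticEnergy Y + ν * (∫⁻ τ in Ioo s T, D τ).toReal ≤ R := by
  obtain ⟨t, ht_mono, ht_mem, ht_lim⟩ := exists_seq_strictMono_tendsto' hsT
  -- continuity from below of the dissipation along the sequence
  have hU : ⋃ n, Ioo s (t n) = Ioo s T := iUnion_Ioo_eq_of_tendsto ht_lim fun n => (ht_mem n).2.le
  have hdir : Directed (· ⊆ ·) fun n => Ioo s (t n) := fun m n =>
    ⟨max m n, Ioo_subset_Ioo_right (ht_mono.monotone (le_max_left m n)),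
      Ioo_subset_Ioo_right (ht_mono.monotone (le_max_right m n))⟩
  have hA : Tendsto (fun n => ∫⁻ τ in Ioo s (t n), D τ) atTop (𝓝 (∫⁻ τ in Ioo s T, D τ)) := by
    rw [← hU, setLIntegral_iUnion_of_directed _ hdir]
    exact tendsto_atTop_iSup fun m n hmn =>
      lintegral_mono_set (Ioo_subset_Ioo_right (ht_mono.monotone hmn))
  have hA' : Tendsto (fun n => (∫⁻ τ in Ioo s (t n), D τ).toReal) atTop
      (𝓝 (∫⁻ τ in Ioo s T, D τ).toReal) :=
    (ENNReal.tendsto_toReal hfin).comp hA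
  -- the pairing along the sequence
  have ht_within : Tendsto t atTop (𝓝[<] T) :=
    tendsto_nhdsWithin_iff.2 ⟨ht_lim, Eventually.of_forall fun n => (ht_mem n).2⟩
  have hP : Tendsto (fun n => ∫ x, ⟪u (t n) x, Y x⟫) atTop (𝓝 (∫ x, ⟪Y x, Y x⟫)) :=
    hweak.comp ht_within
  have hYY : ∫ x, ⟪Y x, Y x⟫ = 2 * VectorCalculus.kineticEnergy Y := by
    simp only [VectorCalculus.kineticEnergy, real_inner_self_eq_norm_sq]
    ring
  have hg : Tendsto (fun n => (∫ x, ⟪u (t n) x, Y x⟫) - VectorCalculus.kineticEnergy Y +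
      ν * (∫⁻ τ in Ioo s (t n), D τ).toReal) atTop
      (𝓝 ((∫ x, ⟪Y x, Y x⟫) - VectorCalculus.kineticEnergy Y + ν * (∫⁻ τ in Ioo s T, D τ).toReal)) :=
    (hP.sub_const _).add (hA'.const_mul ν)
  have hlim_eq : (∫ x, ⟪Y x, Y x⟫) - VectorCalculus.kineticEnergy Y + ν * (∫⁻ τ in Ioo s T, D τ).toReal =
      VectorCalculus.kineticEnergy Y + ν * (∫⁻ τ in Ioo s T, D τ).toReal := by
    rw [hYY]; ring
  rw [← hlim_eq]
  refine le_of_tendsto' hg fun n => ?_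
  have h1 := (abs_le.1 (abs_integral_inner_le_kineticEnergy_add (hu (t n) (ht_mem n)) hY)).2
  have h2 := hineq (t n) (ht_mem n)
  linarith

end Glue

/-! ### The family of slabs -/

section Family

variable {E : Type*} [NormedAddCommGroup E] [InnerProductSpace ℝ E] [FiniteDimensional ℝ E]
  [MeasurableSpace E] [BorelSpace E]
variable {T ν : ℝ} {u : ℝ → E → E} {u₀ : E → E}

/-- Every `t ∈ [0, T)` lies in one of the closed slabs `[0, T']`, `0 < T' < T`
(`T' = (t + T)/2`). [folklore] -/
theorem exists_mem_Ioo_le_of_mem_Ico {t : ℝ} (ht : t ∈ Ico 0 T) : ∃ T' ∈ Ioo 0 T, t ≤ T' :=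
  ⟨(t + T) / 2, ⟨by linarith [ht.1, ht.2], by linarith [ht.2]⟩, by linarith [ht.2]⟩

/-- Every slice `u(t)`, `t ∈ [0, T)`, is square integrable (field `memLp` on a slab containing
`t`; Galdi 2000, Def. 2.1 and Lemma 2.2). [cite: Galdi2000, Lemma 2.2] -/
theorem memLp_of_forall_lt (h : ∀ T' ∈ Ioo 0 T, IsLerayHopfOn T' ν 0 u₀ u) {t : ℝ}
    (ht : t ∈ Ico 0 T) : MemLp (u t) 2 volume := by
  obtain ⟨T', hT', htT'⟩ := exists_mem_Ioo_le_of_mem_Ico ht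
  exact (h T' hT').memLp t ⟨ht.1, htT'⟩

/-- **Uniform energy bound.** The energy inequality from `s = 0` on the slabs (no force,
`ν ≥ 0`) gives `E(u(t)) ≤ E(u₀)` for every `t ∈ [0, T)` (Leray 1934, §31 (5.2)). [cite: Leray1934, §31] -/
theorem kineticEnergy_le_of_forall_lt (hν : 0 ≤ ν) (h : ∀ T' ∈ Ioo 0 T, IsLerayHopfOn T' ν 0 u₀ u)
    {t : ℝ} (ht : t ∈ Ico 0 T) :
    VectorCalculus.kineticEnergy (u t) ≤ VectorCalculus.kineticEnergy u₀ := by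
  obtain ⟨T', hT', htT'⟩ := exists_mem_Ioo_le_of_mem_Ico ht
  obtain ⟨G, -, -, h0, -⟩ := (h T' hT').weakGrad_energy
  have key := h0 t ⟨ht.1, htT'⟩
  simp only [Pi.zero_apply, inner_zero_left, integral_zero, intervalIntegral.integral_zero,
    add_zero] at key
  have hnn : 0 ≤ ν * (∫⁻ τ in Ioo 0 t, ∫⁻ x, ENNReal.ofReal (frobeniusNormSq (G τ x))).toReal :=
    mul_nonneg hν ENNReal.toReal_nonneg
  linarith

/-- The uniform energy bound in extended form: `∫⁻ ‖u(t)‖ₑ² ≤ 2 E(u₀)` for `t ∈ [0, T)`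
(Leray 1934, §31). [cite: Leray1934, §31] -/
theorem eEnergy_le_of_forall_lt (hν : 0 ≤ ν) (h : ∀ T' ∈ Ioo 0 T, IsLerayHopfOn T' ν 0 u₀ u)
    {t : ℝ} (ht : t ∈ Ico 0 T) :
    eEnergy (u t) ≤ ENNReal.ofReal (2 * VectorCalculus.kineticEnergy u₀) := by
  rw [eEnergy_eq_ofReal _ (memLp_of_forall_lt h ht)]
  exact ENNReal.ofReal_le_ofReal (by linarith [kineticEnergy_le_of_forall_lt hν h ht])

/-- The uniform energy bound on the `L²` classes: `‖[u(t)]‖ ≤ (2 E(u₀))^{1/2}` for `t ∈ [0, T)`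
(Leray 1934, §31). [cite: Leray1934, §31] -/
theorem norm_toLp_le_of_forall_lt (hν : 0 ≤ ν) (h : ∀ T' ∈ Ioo 0 T, IsLerayHopfOn T' ν 0 u₀ u)
    {t : ℝ} (ht : t ∈ Ico 0 T) :
    ‖(memLp_of_forall_lt h ht).toLp (u t)‖ ≤ Real.sqrt (2 * VectorCalculus.kineticEnergy u₀) := by
  rw [← Real.sqrt_sq (norm_nonneg _), norm_toLp_sq_eq_two_mul_kineticEnergy]
  exact Real.sqrt_le_sqrt (by linarith [kineticEnergy_le_of_forall_lt hν h ht])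

/-- `u ∈ L^∞(0, T; L²)` in the guarded mixed class (Leray 1934, §31 (a); Galdi 2000,
Def. 2.1 (i)). [cite: Leray1934, §31] -/
theorem memLqLp_of_forall_lt (hν : 0 ≤ ν) (h : ∀ T' ∈ Ioo 0 T, IsLerayHopfOn T' ν 0 u₀ u) :
    MemLqLp ∞ 2 u (Ioo 0 T) := by
  have hae : ∀ᵐ t ∂(volume.restrict (Ioo 0 T)), t ∈ Ioo 0 T := ae_restrict_mem measurableSet_Ioo
  refine ⟨hae.mono fun t ht => memLp_of_forall_lt h (Ioo_subset_Ico_self ht), ?_⟩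
  rw [eLqLpNorm, eLpNorm_exponent_top]
  refine eLpNormEssSup_lt_top_of_ae_bound (C := Real.sqrt (2 * VectorCalculus.kineticEnergy u₀))
    (hae.mono fun t ht => ?_)
  have hmem := memLp_of_forall_lt h (Ioo_subset_Ico_self ht)
  rw [Real.norm_eq_abs, abs_of_nonneg ENNReal.toReal_nonneg, ← Lp.norm_toLp (u t) hmem]
  exact norm_toLp_le_of_forall_lt hν h (Ioo_subset_Ico_self ht)

/-- **Weak continuity inside.** The pairings `t ↦ ∫⟪u(t), w⟫`, `w ∈ L²`, are continuous on
`(0, T)` (field `weak_continuous` on a slab `[0, T']` with `t < T'`; Leray 1934, §31;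
Galdi 2000, Lemma 2.2). [cite: Galdi2000, Lemma 2.2] -/
theorem continuousOn_integral_inner_of_forall_lt (h : ∀ T' ∈ Ioo 0 T, IsLerayHopfOn T' ν 0 u₀ u)
    {w : E → E} (hw : MemLp w 2 volume) :
    ContinuousOn (fun t => ∫ x, ⟪u t x, w x⟫) (Ioo 0 T) := by
  intro t ht
  obtain ⟨T', hT', htT'⟩ : ∃ T' ∈ Ioo 0 T, t < T' :=
    ⟨(t + T) / 2, ⟨by linarith [ht.1, ht.2], by linarith [ht.2]⟩, by linarith [ht.2]⟩
  have hc := ((h T' hT').weak_continuous w hw).1 t ⟨ht.1, htT'.le⟩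
  exact hc.mono_of_mem_nhdsWithin (mem_nhdsWithin_of_mem_nhds
    (mem_of_superset (isOpen_Ioo.mem_nhds ⟨ht.1, htT'⟩) Ioo_subset_Ioc_self))

/-- **`u` is a weak solution on `[0, T)`** (Leray 1934, (17), §31): exhaustion of the weak
formulation (`IsWeakNSSolutionOn.of_forall_lt`), the a.e. strong measurability and the a.e.
divergence constraint being countable unions along `T_n ↑ T`, and the local square
integrability up to `t = T` following from the uniform energy bound by Tonelli. [cite: Leray1934, §31] -/
theorem isWeakNSSolutionOn_of_forall_lt (hT : 0 < T) (hν : 0 ≤ ν)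
    (h : ∀ T' ∈ Ioo 0 T, IsLerayHopfOn T' ν 0 u₀ u) : IsWeakNSSolutionOn T ν 0 u₀ u := by
  obtain ⟨v, -, hv_mem, hv_lim⟩ := exists_seq_strictMono_tendsto' hT
  have hU : ⋃ n, Ioo 0 (v n) = Ioo 0 T := iUnion_Ioo_eq_of_tendsto hv_lim fun n => (hv_mem n).2.le
  -- measurability on the strip
  have hmeas : AEStronglyMeasurable (uncurry u) (volume.restrict (Ioo 0 T ×ˢ univ)) := by
    rw [← hU, iUnion_prod_const]
    exact aestronglyMeasurable_iUnion_iff.2 fun n => (h (v n) (hv_mem n)).weak.1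
  -- weak divergence for a.e. time
  have hdiv : ∀ᵐ t ∂(volume.restrict (Ioo 0 T)), IsWeaklyDivFree (u t) := by
    rw [← hU, ae_restrict_iUnion_iff]
    exact fun n => (h (v n) (hv_mem n)).weak.2.2.1
  refine IsWeakNSSolutionOn.of_forall_lt hT hmeas (fun K _ => ?_) hdiv fun T' hT' => (h T' hT').weak
  -- local square integrability up to `t = T`
  have hAEM : AEMeasurable (fun z : ℝ × E => ‖uncurry u z‖ₑ ^ 2)
      (((volume : Measure ℝ).restrict (Ioo 0 T)).prod (volume : Measure E)) := by
    rw [restrict_prod_volume_eq]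
    exact hmeas.aemeasurable.enorm.pow_const 2
  have hbound : ∀ᵐ t ∂(volume.restrict (Ioo 0 T)),
      ∫⁻ x, ‖u t x‖ₑ ^ 2 ≤ ENNReal.ofReal (2 * VectorCalculus.kineticEnergy u₀) :=
    (ae_restrict_mem measurableSet_Ioo).mono fun t ht =>
      eEnergy_le_of_forall_lt hν h (Ioo_subset_Ico_self ht)
  calc ∫⁻ z in Ioo 0 T ×ˢ K, ‖uncurry u z‖ₑ ^ 2
      ≤ ∫⁻ z in Ioo 0 T ×ˢ univ, ‖uncurry u z‖ₑ ^ 2 :=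
        lintegral_mono_set (prod_mono Subset.rfl (subset_univ K))
    _ = ∫⁻ t in Ioo 0 T, ∫⁻ x, ‖u t x‖ₑ ^ 2 := by
        rw [← restrict_prod_volume_eq, lintegral_prod _ hAEM]
        rfl
    _ ≤ ∫⁻ _ in Ioo 0 T, ENNReal.ofReal (2 * VectorCalculus.kineticEnergy u₀) := lintegral_mono_ae hbound
    _ < ∞ := by
        rw [setLIntegral_const]
        exact ENNReal.mul_lt_top ENNReal.ofReal_lt_top measure_Ioo_lt_top

/-- **Patching the weak gradients of the slabs.** For `ν > 0` there is one `G` on `(0, T)`,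
a weak gradient of `u(t)` for a.e. `t ∈ (0, T)`, with finite dissipation
`∫_{(0,T)} ∫ |G|² ≤ E(u₀)/ν`, such that the energy inequality from `0` holds for every
`t ∈ [0, T)` and the energy inequality from a.e. `s ∈ (0, T)` holds for every `t ∈ [s, T)`
(no force). Proof: along `T_n ↑ T` the gradients `G_n` of the slabs `[0, T_n]` are weak
gradients of the same slices, hence agree a.e. in space for a.e. time
(`HasWeakFDerivOn.unique_holds`, Evans, §5.2.1); `G(t) := G_n(t)` for some `n` with `t < T_n`
therefore has the dissipation of every `G_n` on `(0, T_n)`, which transports the inequalities,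
and `∫_{(0,T)} = supₙ ∫_{(0,T_n)}` bounds the total dissipation (Leray 1934, §32–§33, the
passage from the regular intervals to the whole of `(0, T)`). [cite: Leray1934, §32] -/
theorem exists_hasWeakGradient_of_forall_lt (hT : 0 < T) (hν : 0 < ν)
    (h : ∀ T' ∈ Ioo 0 T, IsLerayHopfOn T' ν 0 u₀ u) :
    ∃ G : ℝ → E → E →L[ℝ] E,
      (∀ᵐ t ∂(volume.restrict (Ioo 0 T)), HasWeakGradient (u t) (G t)) ∧
      (∫⁻ t in Ioo 0 T, ∫⁻ x, ENNReal.ofReal (frobeniusNormSq (G t x)) < ∞) ∧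
      (∀ t ∈ Ico 0 T, VectorCalculus.kineticEnergy (u t) +
        ν * (∫⁻ τ in Ioo 0 t, ∫⁻ x, ENNReal.ofReal (frobeniusNormSq (G τ x))).toReal ≤
        VectorCalculus.kineticEnergy u₀) ∧
      (∀ᵐ s ∂(volume.restrict (Ioo 0 T)), ∀ t ∈ Ico s T, VectorCalculus.kineticEnergy (u t) +
        ν * (∫⁻ τ in Ioo s t, ∫⁻ x, ENNReal.ofReal (frobeniusNormSq (G τ x))).toReal ≤
          VectorCalculus.kineticEnergy (u s)) := by
  classical
  haveI : CompleteSpace E := FiniteDimensional.complete ℝ E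
  obtain ⟨v, hv_mono, hv_mem, hv_lim⟩ := exists_seq_strictMono_tendsto' hT
  have hU : ⋃ n, Ioo 0 (v n) = Ioo 0 T := iUnion_Ioo_eq_of_tendsto hv_lim fun n => (hv_mem n).2.le
  -- the gradients of the slabs, with the force term removed
  have hslab : ∀ n, ∃ G : ℝ → E → E →L[ℝ] E,
      (∀ᵐ t ∂(volume.restrict (Ioo 0 (v n))), HasWeakGradient (u t) (G t)) ∧
      (∫⁻ t in Ioo 0 (v n), ∫⁻ x, ENNReal.ofReal (frobeniusNormSq (G t x)) < ∞) ∧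
      (∀ t ∈ Icc 0 (v n), VectorCalculus.kineticEnergy (u t) +
        ν * (∫⁻ τ in Ioo 0 t, ∫⁻ x, ENNReal.ofReal (frobeniusNormSq (G τ x))).toReal ≤
        VectorCalculus.kineticEnergy u₀) ∧
      (∀ᵐ s ∂(volume.restrict (Ioo 0 (v n))), ∀ t ∈ Icc s (v n),
        VectorCalculus.kineticEnergy (u t) +
          ν * (∫⁻ τ in Ioo s t, ∫⁻ x, ENNReal.ofReal (frobeniusNormSq (G τ x))).toReal ≤
          VectorCalculus.kineticEnergy (u s)) := by
    intro n
    obtain ⟨G, hG, hfin, h0, hs⟩ := (h (v n) (hv_mem n)).weakGrad_energy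
    refine ⟨G, hG, hfin, fun t ht => ?_, ?_⟩
    · simpa only [Pi.zero_apply, inner_zero_left, integral_zero,
        intervalIntegral.integral_zero, add_zero] using h0 t ht
    · filter_upwards [hs] with s hs' t ht
      simpa only [Pi.zero_apply, inner_zero_left, integral_zero,
        intervalIntegral.integral_zero, add_zero] using hs' t ht
  choose G hG hGfin hG0 hGs using hslab
  -- an index `n` with `t < T_n`, for `t < T`
  have hex : ∀ {t : ℝ}, t < T → ∃ n, t < v n := fun ht =>
    (hv_lim.eventually (lt_mem_nhds ht)).exists
  -- the patched gradient
  let Gp : ℝ → E → E →L[ℝ] E := fun t =>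
    if ht : t < T then G (Classical.choose (hex ht)) t else 0
  have hGp : ∀ {t : ℝ} (ht : t < T), Gp t = G (Classical.choose (hex ht)) t := fun ht => dif_pos ht
  -- a.e. in `(0, T)`, every slab gradient is a weak gradient where it is defined
  have hall : ∀ᵐ t ∂(volume.restrict (Ioo 0 T)), ∀ n, t < v n → HasWeakGradient (u t) (G n t) := by
    rw [ae_all_iff]
    intro n
    have h1 := (ae_restrict_iff' measurableSet_Ioo).1 (hG n)
    rw [ae_restrict_iff' measurableSet_Ioo]
    filter_upwards [h1] with t ht htT htn
    exact ht ⟨htT.1, htn⟩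
  have hGp_grad : ∀ᵐ t ∂(volume.restrict (Ioo 0 T)), HasWeakGradient (u t) (Gp t) := by
    filter_upwards [hall, ae_restrict_mem measurableSet_Ioo] with t ht htT
    rw [hGp htT.2]
    exact ht _ (Classical.choose_spec (hex htT.2))
  -- the patched dissipation agrees with the slab dissipations (uniqueness of weak gradients)
  have hDp_eq : ∀ n, ∀ᵐ τ ∂(volume.restrict (Ioo 0 (v n))),
      ∫⁻ x, ENNReal.ofReal (frobeniusNormSq (Gp τ x)) =
        ∫⁻ x, ENNReal.ofReal (frobeniusNormSq (G n τ x)) := by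
    intro n
    have h1 := (ae_restrict_iff' measurableSet_Ioo).1 hall
    rw [ae_restrict_iff' measurableSet_Ioo]
    filter_upwards [h1] with τ hτ hτn
    have hτT : τ < T := hτn.2.trans (hv_mem n).2
    have hall' := hτ ⟨hτn.1, hτT⟩
    have hae : Gp τ =ᵐ[volume] G n τ := by
      rw [hGp hτT]
      have := FunctionSpaces.HasWeakFDerivOn.unique_holds
        (hall' _ (Classical.choose_spec (hex hτT))) (hall' n hτn.2)
      rwa [Opens.coe_top, Measure.restrict_univ] at this
    exact lintegral_congr_ae (hae.mono fun x hx => by simp only [hx])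
  have hDp_Ioo : ∀ {n : ℕ} {s t : ℝ}, 0 ≤ s → t ≤ v n →
      ∫⁻ τ in Ioo s t, ∫⁻ x, ENNReal.ofReal (frobeniusNormSq (Gp τ x)) =
        ∫⁻ τ in Ioo s t, ∫⁻ x, ENNReal.ofReal (frobeniusNormSq (G n τ x)) := by
    intro n s t hs htn
    have hsub : Ioo s t ⊆ Ioo 0 (v n) := fun τ hτ => ⟨hs.trans_lt hτ.1, hτ.2.trans_le htn⟩
    exact lintegral_congr_ae (ae_mono (Measure.restrict_mono hsub le_rfl) (hDp_eq n))
  -- the energy inequality from `0` for `t < T`, and finiteness of the dissipation there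
  have h0p : ∀ t ∈ Ico 0 T, VectorCalculus.kineticEnergy (u t) +
      ν * (∫⁻ τ in Ioo 0 t, ∫⁻ x, ENNReal.ofReal (frobeniusNormSq (Gp τ x))).toReal ≤
        VectorCalculus.kineticEnergy u₀ ∧
      ∫⁻ τ in Ioo 0 t, ∫⁻ x, ENNReal.ofReal (frobeniusNormSq (Gp τ x)) < ∞ := by
    intro t ht
    obtain ⟨n, hn⟩ := hex ht.2
    rw [hDp_Ioo le_rfl hn.le]
    exact ⟨hG0 n t ⟨ht.1, hn.le⟩,
      lt_of_le_of_lt (lintegral_mono_set (Ioo_subset_Ioo_right hn.le)) (hGfin n)⟩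
  -- finiteness of the total dissipation: continuity from below along `T_n ↑ T`
  have hdir : Directed (· ⊆ ·) fun n => Ioo (0 : ℝ) (v n) := fun m n =>
    ⟨max m n, Ioo_subset_Ioo_right (hv_mono.monotone (le_max_left m n)),
      Ioo_subset_Ioo_right (hv_mono.monotone (le_max_right m n))⟩
  have hfinT : ∫⁻ τ in Ioo 0 T, ∫⁻ x, ENNReal.ofReal (frobeniusNormSq (Gp τ x)) < ∞ := by
    rw [← hU, setLIntegral_iUnion_of_directed _ hdir]
    refine lt_of_le_of_lt (iSup_le fun n => ?_)
      (ENNReal.ofReal_lt_top (r := VectorCalculus.kineticEnergy u₀ / ν))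
    obtain ⟨hineq, hfin⟩ := h0p (v n) ⟨(hv_mem n).1.le, (hv_mem n).2⟩
    have hK := kineticEnergy_nonneg (u (v n))
    rw [← ENNReal.ofReal_toReal hfin.ne]
    refine ENNReal.ofReal_le_ofReal ?_
    rw [le_div_iff₀ hν, mul_comm]
    linarith
  -- the energy inequality from a.e. `s` for `t < T`
  have hall_s : ∀ᵐ s ∂(volume.restrict (Ioo 0 T)), ∀ n, s < v n → ∀ t ∈ Icc s (v n),
      VectorCalculus.kineticEnergy (u t) +
        ν * (∫⁻ τ in Ioo s t, ∫⁻ x, ENNReal.ofReal (frobeniusNormSq (G n τ x))).toReal ≤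
        VectorCalculus.kineticEnergy (u s) := by
    rw [ae_all_iff]
    intro n
    have h1 := (ae_restrict_iff' measurableSet_Ioo).1 (hGs n)
    rw [ae_restrict_iff' measurableSet_Ioo]
    filter_upwards [h1] with s hs hsT hsn
    exact hs ⟨hsT.1, hsn⟩
  have hsp : ∀ᵐ s ∂(volume.restrict (Ioo 0 T)), ∀ t ∈ Ico s T, VectorCalculus.kineticEnergy (u t) +
      ν * (∫⁻ τ in Ioo s t, ∫⁻ x, ENNReal.ofReal (frobeniusNormSq (Gp τ x))).toReal ≤
        VectorCalculus.kineticEnergy (u s) := by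
    filter_upwards [hall_s, ae_restrict_mem measurableSet_Ioo] with s hs hsT t ht
    obtain ⟨n, hn⟩ := hex ht.2
    rw [hDp_Ioo hsT.1.le hn.le]
    exact hs n (lt_of_le_of_lt ht.1 hn) t ⟨ht.1, hn.le⟩
  exact ⟨Gp, hGp_grad, hfinT, fun t ht => (h0p t ht).1, hsp⟩

end Family

end Literature.Analysis.FluidPDE
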